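import Summits.KontsevichZagierPeriods.KontsevichZagierPeriods.Theorems.RootDecompWalshStrataSplit4Descent
import Summits.KontsevichZagierPeriods.KontsevichZagierPeriods.Theorems.RootDecompWalshStrataBall4Planar
import Summits.KontsevichZagierPeriods.KontsevichZagierPeriods.Theorems.RootDecompWalshStrataPiSector
import Literature.NumberTheory.Transcendental.BoxIntegralZetaValues

/-!
# The split specimen `x₀x₁ + x₂x₃ > 1` meets Euler, part 1/2: `Δ_q = [ζ(2)-square] + two rational pieces`

Route `RootDecompWalshStrata` (cell decomp-kz, lens 4, gen 12), support toward `QuadricSignKernel`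
(item stmt-KontsevichZagierPeriods-25393), slice `d = 4`.  Gen 11 descended the split quadric cell to
the RATIONAL 2-cell `Δ_q = [Δ, q(t₀+t₁−1)²/(2t₀t₁)]` over the triangle `Δ = (0,1)² ∩ {t₀ + t₁ > 1}`
(`Split4Descent`, value `q(π²/12 − 3/4)`).  Here, INSIDE the three rules:
`(t₀+t₁−1)²/(2t₀t₁) = 1/(2t₀t₁) + (t₀−2)/(2t₁) + ((t₁−2)/(2t₀) + 1)` and the polynomial chart
`Ψ(x,y) = (y, 1 − xy)` of the open square onto `Δ` (`|det Ψ'| = y`) under which `[Δ, c/(t₀t₁)]`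
becomes BEUKERS' SQUARE `zRep c = [(0,1)², c/(1 − xy)]` (value `c·ζ(2) = c·π²/6`; integrable by the
tree's `box_integral_one_div_one_sub_mul_two`).  All pieces are transported through `Ψ`, so every
integrability is inherited from Beukers' integrand (domination) — no improper integral is evaluated.
Main result `of_triRep_sub_pieces_mem_relations`:
`[Δ_q] − [zRep (q/2)] − [A_q] − [B_q] ∈ KZ.relations` with the RATIONAL pieces
`A_q = [Δ, q(t₀−2)/(2t₁)]`, `B_q = [Δ, q(t₁−2)/(2t₀) + q]` (fibrewise-constant denominators; part 2
integrates them to the constants `−5q/8`, `−q/8` by Newton–Leibniz).  0 sorry.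
[KontsevichZagier2001 §1.2; Beukers1979 §2; this node]
-/

noncomputable section

open Literature.NumberTheory.Transcendental
open MeasureTheory Set
open MvPolynomial (aeval X C)
open Literature.ModelTheory.ExponentialFields (IsSemialgebraic isSemialgebraic_setOf_eval_pos)
open Summit.KontsevichZagierPeriods.RootDecompWalshStrata.Ball4 (sqSet isSemialgebraic_sqSet
  sqSet_subset_Icc)
open Summit.KontsevichZagierPeriods.RootDecompWalshStrata.Split4 (triSet triRep triRep_domain
  triRep_integrand mem_triSet isSemialgebraic_triSet triSet_subset_Icc integrableOn_of_bdd)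

namespace Summit.KontsevichZagierPeriods.RootDecompWalshStrata.Split4Pi

/-! #### Beukers' square `zRep c = [(0,1)², c/(1 − xy)]` -/

/-- Membership in the open square. [definition] -/
theorem mem_sqSet {z : Fin 2 → ℝ} : z ∈ sqSet ↔ (0 < z 0 ∧ z 0 < 1) ∧ (0 < z 1 ∧ z 1 < 1) := by
  simp only [sqSet, mem_setOf_eq, Fin.forall_fin_two]

/-- On the open square `1 − xy > 0`. [folklore] -/
theorem one_sub_mul_pos {z : Fin 2 → ℝ} (hz : z ∈ sqSet) : 0 < 1 - z 0 * z 1 := by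
  obtain ⟨⟨h0, h0'⟩, h1, h1'⟩ := mem_sqSet.1 hz
  nlinarith [mul_lt_mul'' h0' h1' h0.le h1.le]

/-- The open square of the Beukers file is `sqSet`. [definition] -/
theorem beukersSet_eq : {x : Fin 2 → ℝ | ∀ i, x i ∈ Ioo (0 : ℝ) 1} = sqSet := rfl

/-- **Beukers' integrand `1/(1 − xy)` is integrable on the open square** (tree:
`box_integral_one_div_one_sub_mul_two`). [Beukers1979 §2] -/
theorem integrableOn_beukers : IntegrableOn (fun z : Fin 2 → ℝ => 1 / (1 - z 0 * z 1)) sqSet := by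
  have h := box_integral_one_div_one_sub_mul_two.1
  rwa [beukersSet_eq] at h

/-- Domination by Beukers' integrand gives integrability on the square. [folklore] -/
theorem integrableOn_sq_of_le {f : (Fin 2 → ℝ) → ℝ} (hf : Measurable f) (M : ℝ)
    (hb : ∀ z ∈ sqSet, |f z| ≤ M / (1 - z 0 * z 1)) : IntegrableOn f sqSet := by
  have hg : IntegrableOn (fun z : Fin 2 → ℝ => M * (1 / (1 - z 0 * z 1))) sqSet :=
    integrableOn_beukers.const_mul M
  exact Integrable.mono' hg hf.aestronglyMeasurable
    (ae_restrict_of_forall_mem isSemialgebraic_sqSet.measurableSet_holds fun z hz => by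
      rw [Real.norm_eq_abs, ← div_eq_mul_one_div]; exact hb z hz)

/-- **`zRep c = [(0,1)², c/(1 − xy)]`** — Beukers' representation of `c·ζ(2)` (a RATIONAL 2-cell with
a rational integrand). [Beukers1979 §2; KontsevichZagier2001 §1.1] -/
def zRep (c : ℚ) : KZ.IntegralRep 2 where
  domain := sqSet
  integrand z := (c : ℝ) / (1 - z 0 * z 1)
  isSemialgebraic_domain := isSemialgebraic_sqSet
  isSemialgebraicFunOn_integrand :=
    (isSemialgebraicFunOn_aeval_div_aeval isSemialgebraic_sqSet (C c) (1 - X 0 * X 1)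
      fun z hz => by simpa using (one_sub_mul_pos hz).ne').congr fun z _ => by simp
  integrableOn := by
    refine integrableOn_sq_of_le (by fun_prop) |(c : ℝ)| fun z hz => ?_
    rw [abs_div, abs_of_pos (one_sub_mul_pos hz)]

/-- The domain of `zRep c`. [definition] -/
@[simp] theorem zRep_domain (c : ℚ) : (zRep c).domain = sqSet := rfl
/-- The integrand of `zRep c`. [definition] -/
@[simp] theorem zRep_integrand (c : ℚ) (z : Fin 2 → ℝ) :
    (zRep c).integrand z = (c : ℝ) / (1 - z 0 * z 1) := rfl

/-- **`value (zRep c) = c·π²/6`** (`= c·ζ(2)`; Beukers / the tree's box integral). [Beukers1979 §2] -/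
theorem value_zRep (c : ℚ) : (zRep c).value = (c : ℝ) * (Real.pi ^ 2 / 6) := by
  rw [KZ.IntegralRep.value, zRep_domain, ← beukersSet_eq, ← box_integral_one_div_one_sub_mul_two.2,
    ← integral_const_mul]
  refine setIntegral_congr_fun (by rw [beukersSet_eq]; exact isSemialgebraic_sqSet.measurableSet_holds)
    fun z _ => ?_
  simp only [zRep_integrand]
  ring

/-- `zRep c` is a rational representation. [KontsevichZagier2001 §1.1] -/
theorem isRational_zRep (c : ℚ) : (zRep c).IsRational :=
  ⟨C c, 1 - X 0 * X 1, fun z hz => by simpa using (one_sub_mul_pos hz).ne', fun z _ => by simp⟩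

/-! #### The chart `Ψ(x,y) = (y, 1 − xy)` of the square onto the triangle -/

/-- The chart as a polynomial map. [definition] -/
def psiPoly : Fin 2 → MvPolynomial (Fin 2) ℚ := ![X 1, 1 - X 0 * X 1]

/-- `Ψ(x, y) = (y, 1 − xy)`. [definition] -/
def psi : (Fin 2 → ℝ) → (Fin 2 → ℝ) := fun z j => aeval z (psiPoly j)

/-- `Ψ(z)₀ = z₁`. [definition] -/
@[simp] theorem psi_zero (z : Fin 2 → ℝ) : psi z 0 = z 1 := by simp [psi, psiPoly]
/-- `Ψ(z)₁ = 1 − z₀z₁`. [definition] -/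
@[simp] theorem psi_one (z : Fin 2 → ℝ) : psi z 1 = 1 - z 0 * z 1 := by simp [psi, psiPoly]

/-- The Jacobian matrix of `Ψ`. [calculus] -/
def psiMat (z : Fin 2 → ℝ) : Matrix (Fin 2) (Fin 2) ℝ := !![0, 1; -z 1, -z 0]

/-- The derivative of `Ψ`. [calculus] -/
def psi' (z : Fin 2 → ℝ) : (Fin 2 → ℝ) →L[ℝ] (Fin 2 → ℝ) :=
  LinearMap.toContinuousLinearMap (Matrix.toLin' (psiMat z))

/-- `Ψ'(z)` acts by the Jacobian matrix. [calculus] -/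
theorem psi'_apply (z v : Fin 2 → ℝ) (a : Fin 2) : psi' z v a = ∑ b, psiMat z a b * v b := by
  change Matrix.toLin' (psiMat z) v a = _
  rw [Matrix.toLin'_apply]
  rfl

/-- `det Ψ'(z) = z₁`. [calculus] -/
theorem psi'_det (z : Fin 2 → ℝ) : (psi' z).det = z 1 := by
  change LinearMap.det (Matrix.toLin' (psiMat z)) = _
  rw [LinearMap.det_toLin', psiMat, Matrix.det_fin_two]
  simp

/-- `Ψ` is differentiable with derivative `Ψ'`. [calculus] -/
theorem hasFDerivAt_psi (z : Fin 2 → ℝ) : HasFDerivAt psi (psi' z) z := by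
  have h0 : HasFDerivAt (fun w : Fin 2 → ℝ => psi w 0) ((ContinuousLinearMap.proj 0).comp (psi' z)) z := by
    have hf : (fun w : Fin 2 → ℝ => psi w 0) = fun w => w 1 := funext psi_zero
    rw [hf]
    refine (hasFDerivAt_apply 1 z).congr_fderiv (ContinuousLinearMap.ext fun v => ?_)
    simp [psi'_apply, psiMat, Fin.sum_univ_two]
  have h1 : HasFDerivAt (fun w : Fin 2 → ℝ => psi w 1) ((ContinuousLinearMap.proj 1).comp (psi' z)) z := by
    have hf : (fun w : Fin 2 → ℝ => psi w 1) = fun w => 1 - w 0 * w 1 := funext psi_one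
    rw [hf]
    refine (((hasFDerivAt_apply 0 z).mul (hasFDerivAt_apply 1 z)).const_sub 1).congr_fderiv
      (ContinuousLinearMap.ext fun v => ?_)
    simp [psi'_apply, psiMat, Fin.sum_univ_two, mul_comm]
  refine hasFDerivAt_pi'' fun a => ?_
  fin_cases a
  · exact h0
  · exact h1

/-- `Ψ` is injective on the square (indeed where `z₁ ≠ 0`). [calculus] -/
theorem injOn_psi : InjOn psi sqSet := by
  intro x hx y _ hxy
  have e0 : x 1 = y 1 := by simpa using congrFun hxy 0
  have e1 : 1 - x 0 * x 1 = 1 - y 0 * y 1 := by simpa using congrFun hxy 1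
  have h1 : x 1 ≠ 0 := (mem_sqSet.1 hx).2.1.ne'
  have h0 : x 0 = y 0 := by
    have h : x 0 * x 1 = y 0 * x 1 := by rw [e0] at e1 ⊢; linarith
    exact mul_right_cancel₀ h1 h
  funext a; fin_cases a
  · exact h0
  · exact e0

/-- **`Ψ` maps the open square onto the triangle `Δ`** (inverse `(x, y) = ((1 − t₁)/t₀, t₀)`). [calculus] -/
theorem image_psi : psi '' sqSet = triSet := by
  ext t
  rw [mem_image, mem_triSet]
  constructor
  · rintro ⟨z, hz, rfl⟩
    obtain ⟨⟨h0, h0'⟩, h1, h1'⟩ := mem_sqSet.1 hz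
    have hp : 0 < z 0 * z 1 := mul_pos h0 h1
    have hlt : z 0 * z 1 < z 1 := by nlinarith
    simp only [psi_zero, psi_one]
    exact ⟨⟨⟨h1, h1'⟩, by linarith, by linarith⟩, by nlinarith⟩
  · rintro ⟨⟨⟨h0, h0'⟩, h1, h1'⟩, hc⟩
    refine ⟨![(1 - t 1) / t 0, t 0], ?_, ?_⟩
    · rw [mem_sqSet]
      simp only [Matrix.cons_val_zero, Matrix.cons_val_one, Matrix.cons_val_fin_one]
      exact ⟨⟨div_pos (by linarith) h0, (div_lt_one h0).2 (by linarith)⟩, h0, h0'⟩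
    · funext a; fin_cases a
      · simp
      · simp only [Fin.reduceFinMk, psi_one, Matrix.cons_val_zero, Matrix.cons_val_one,
          Matrix.cons_val_fin_one]
        field_simp
        ring

/-- `Ψ` is a `ℚ`-semialgebraic map on the square. [BCR1998 §2.2] -/
theorem isSemialgebraicMapOn_psi : IsSemialgebraicMapOn ℚ sqSet psi :=
  isSemialgebraicMapOn_aeval isSemialgebraic_sqSet psiPoly

/-- **Transport of integrability through `Ψ`:** `g` is integrable on `Δ` as soon as
`z ↦ z₁ · g(Ψ z)` is integrable on the square. [Federer1969 3.2.5 (Mathlib's change of variables)] -/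
theorem integrableOn_triSet_of_sq {g : (Fin 2 → ℝ) → ℝ}
    (h : IntegrableOn (fun z => z 1 * g (psi z)) sqSet) : IntegrableOn g triSet := by
  rw [← image_psi, integrableOn_image_iff_integrableOn_abs_det_fderiv_smul volume
    isSemialgebraic_sqSet.measurableSet_holds (fun z _ => (hasFDerivAt_psi z).hasFDerivWithinAt)
    injOn_psi]
  refine h.congr_fun (fun z hz => ?_) isSemialgebraic_sqSet.measurableSet_holds
  rw [psi'_det, abs_of_pos (mem_sqSet.1 hz).2.1, smul_eq_mul]

/-- A rule-(2) move along `Ψ`: `[(0,1)², f] − [Δ, g] ∈ KZ.relations` whenever `f(z) = g(Ψ z)·z₁` on the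
square. [KontsevichZagier2001 §1.2 rule (2)] -/
theorem of_sub_of_mem_relations_psi (r : KZ.IntegralRep 2) (r' : KZ.IntegralRep 2)
    (hr : r.domain = sqSet) (hr' : r'.domain = triSet)
    (h : ∀ z ∈ sqSet, r.integrand z = r'.integrand (psi z) * z 1) :
    KZ.of r - KZ.of r' ∈ KZ.relations := by
  refine KZ.changeOfVariablesRel_subset_relations ⟨2, r, r', psi, psi', ?_,
    fun z _ => (hasFDerivAt_psi z).hasFDerivWithinAt, ?_, ?_, fun z hz => ?_, rfl⟩
  · rw [hr]; exact isSemialgebraicMapOn_psi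
  · rw [hr]; exact injOn_psi
  · rw [hr', hr, image_psi]
  · rw [hr] at hz
    rw [psi'_det, abs_of_pos (mem_sqSet.1 hz).2.1]
    exact h z hz

/-! #### The pieces on the triangle and their transports -/

/-- On `Δ` both coordinates are positive. [folklore] -/
theorem pos_of_mem_triSet {t : Fin 2 → ℝ} (ht : t ∈ triSet) : 0 < t 0 ∧ 0 < t 1 :=
  ⟨(mem_triSet.1 ht).1.1.1, (mem_triSet.1 ht).1.2.1⟩

/-- **`A_q = [Δ, q(t₀ − 2)/(2t₁)]`** (denominator constant on the fibres `t₁ = const`); integrable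
because its transport `q·y(y−2)/(2(1−xy))` is dominated by Beukers' integrand. [KontsevichZagier2001 §1.1] -/
def aRep (q : ℚ) : KZ.IntegralRep 2 where
  domain := triSet
  integrand t := (q : ℝ) * (t 0 - 2) / (2 * t 1)
  isSemialgebraic_domain := isSemialgebraic_triSet
  isSemialgebraicFunOn_integrand :=
    (isSemialgebraicFunOn_aeval_div_aeval isSemialgebraic_triSet (C q * (X 0 - 2)) (2 * X 1)
      fun t ht => by simpa using (pos_of_mem_triSet ht).2.ne').congr fun t _ => by simp
  integrableOn := by
    refine integrableOn_triSet_of_sq (integrableOn_sq_of_le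
      (by simp only [psi_zero, psi_one]; fun_prop) |(q : ℝ)| fun z hz => ?_)
    obtain ⟨⟨h0, h0'⟩, h1, h1'⟩ := mem_sqSet.1 hz
    have hw := one_sub_mul_pos hz
    have e : z 1 * ((q:ℝ) * (z 1 - 2) / (2 * (1 - z 0 * z 1))) =
        (q:ℝ) * (z 1 * (z 1 - 2) / 2) / (1 - z 0 * z 1) := by
      have hw' := hw.ne'
      have h1' : z 1 ≠ 0 := h1.ne'
      field_simp
    rw [psi_zero, psi_one, e, abs_div, abs_of_pos hw, abs_mul]
    refine div_le_div_of_nonneg_right (mul_le_of_le_one_right (abs_nonneg _) ?_) hw.le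
    rw [abs_le]; constructor <;> nlinarith

/-- The domain of `A_q`. [definition] -/
@[simp] theorem aRep_domain (q : ℚ) : (aRep q).domain = triSet := rfl
/-- The integrand of `A_q`. [definition] -/
@[simp] theorem aRep_integrand (q : ℚ) (t : Fin 2 → ℝ) :
    (aRep q).integrand t = (q : ℝ) * (t 0 - 2) / (2 * t 1) := rfl

/-- **`B_q = [Δ, q(t₁ − 2)/(2t₀) + q]`** (denominator constant on the fibres `t₀ = const`); its transport
`q(−1−xy)/2 + q·y` is a bounded polynomial. [KontsevichZagier2001 §1.1] -/
def bRep (q : ℚ) : KZ.IntegralRep 2 where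
  domain := triSet
  integrand t := (q : ℝ) * (t 1 - 2) / (2 * t 0) + q
  isSemialgebraic_domain := isSemialgebraic_triSet
  isSemialgebraicFunOn_integrand :=
    (isSemialgebraicFunOn_aeval_div_aeval isSemialgebraic_triSet (C q * (X 1 - 2) + C q * (2 * X 0))
      (2 * X 0) fun t ht => by simpa using (pos_of_mem_triSet ht).1.ne').congr fun t ht => by
        have h0 := (pos_of_mem_triSet ht).1.ne'
        simp
        field_simp
  integrableOn := by
    refine integrableOn_triSet_of_sq (integrableOn_of_bdd sqSet_subset_Icc
      isSemialgebraic_sqSet.measurableSet_holds (by simp only [psi_zero, psi_one]; fun_prop)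
      (3 * |(q : ℝ)|) fun z hz => ?_)
    obtain ⟨⟨h0, h0'⟩, h1, h1'⟩ := mem_sqSet.1 hz
    rw [psi_zero, psi_one]
    have : z 1 * ((q:ℝ) * (1 - z 0 * z 1 - 2) / (2 * z 1) + q) =
        (q:ℝ) * ((-1 - z 0 * z 1) / 2 + z 1) := by field_simp; ring
    rw [this, abs_mul]
    have hb : |(-1 - z 0 * z 1) / 2 + z 1| ≤ 3 := by
      rw [abs_le]; constructor <;> nlinarith [mul_pos h0 h1]
    nlinarith [abs_nonneg (q:ℝ), abs_nonneg ((-1 - z 0 * z 1) / 2 + z 1)]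

/-- The domain of `B_q`. [definition] -/
@[simp] theorem bRep_domain (q : ℚ) : (bRep q).domain = triSet := rfl
/-- The integrand of `B_q`. [definition] -/
@[simp] theorem bRep_integrand (q : ℚ) (t : Fin 2 → ℝ) :
    (bRep q).integrand t = (q : ℝ) * (t 1 - 2) / (2 * t 0) + q := rfl

/-- **`Z_q = [Δ, q/(2t₀t₁)]`** — the `ζ(2)`-carrying piece (transport: Beukers' `(q/2)/(1−xy)`).
[KontsevichZagier2001 §1.1; Beukers1979 §2] -/
def ztRep (q : ℚ) : KZ.IntegralRep 2 where
  domain := triSet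
  integrand t := (q : ℝ) / (2 * (t 0 * t 1))
  isSemialgebraic_domain := isSemialgebraic_triSet
  isSemialgebraicFunOn_integrand :=
    (isSemialgebraicFunOn_aeval_div_aeval isSemialgebraic_triSet (C q) (2 * (X 0 * X 1))
      fun t ht => by
        have h := pos_of_mem_triSet ht
        simpa using (mul_pos h.1 h.2).ne').congr fun t _ => by simp
  integrableOn := by
    refine integrableOn_triSet_of_sq (integrableOn_sq_of_le
      (by simp only [psi_zero, psi_one]; fun_prop) |(q : ℝ) / 2| fun z hz => ?_)
    obtain ⟨⟨h0, h0'⟩, h1, h1'⟩ := mem_sqSet.1 hz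
    have hw := one_sub_mul_pos hz
    rw [psi_zero, psi_one]
    have : z 1 * ((q:ℝ) / (2 * (z 1 * (1 - z 0 * z 1)))) = ((q:ℝ) / 2) / (1 - z 0 * z 1) := by
      field_simp
    rw [this, abs_div, abs_of_pos hw]

/-- The domain of `Z_q`. [definition] -/
@[simp] theorem ztRep_domain (q : ℚ) : (ztRep q).domain = triSet := rfl
/-- The integrand of `Z_q`. [definition] -/
@[simp] theorem ztRep_integrand (q : ℚ) (t : Fin 2 → ℝ) :
    (ztRep q).integrand t = (q : ℝ) / (2 * (t 0 * t 1)) := rfl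

/-- The sum `A_q + B_q` as one representation. [definition] -/
def abRep (q : ℚ) : KZ.IntegralRep 2 where
  domain := triSet
  integrand t := (aRep q).integrand t + (bRep q).integrand t
  isSemialgebraic_domain := isSemialgebraic_triSet
  isSemialgebraicFunOn_integrand := IsSemialgebraicFunOn.add_holds (aRep q).isSemialgebraicFunOn_integrand
    (bRep q).isSemialgebraicFunOn_integrand
  integrableOn := (aRep q).integrableOn.add (bRep q).integrableOn

/-! #### The decomposition inside the rules -/

/-- **`Z_q ≡ zRep (q/2)`** by the chart `Ψ` (rule (2)): `(q/(2·y(1−xy)))·y = (q/2)/(1−xy)`.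
[KontsevichZagier2001 §1.2 rule (2); Beukers1979 §2] -/
theorem of_zRep_sub_of_ztRep_mem_relations (q : ℚ) :
    KZ.of (zRep (q / 2)) - KZ.of (ztRep q) ∈ KZ.relations := by
  refine of_sub_of_mem_relations_psi _ _ rfl rfl fun z hz => ?_
  obtain ⟨⟨h0, h0'⟩, h1, h1'⟩ := mem_sqSet.1 hz
  have hw := (one_sub_mul_pos hz).ne'
  rw [zRep_integrand, ztRep_integrand, psi_zero, psi_one]
  push_cast
  field_simp

/-- **`Δ_q ≡ Z_q + (A_q + B_q)`** — one integrand additivity on `Δ` (the algebraic identity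
`(t₀+t₁−1)² = 1 + t₀(t₀−2) + t₁(t₁−2) + 2t₀t₁`). [KontsevichZagier2001 §1.2 rule (1)] -/
theorem of_triRep_sub_mem_relations (q : ℚ) :
    KZ.of (triRep q) - KZ.of (ztRep q) - KZ.of (abRep q) ∈ KZ.relations :=
  KZ.integrandAddRel_subset_relations ⟨2, triRep q, ztRep q, abRep q, rfl, rfl, fun t ht => by
    have h := pos_of_mem_triSet ht
    have h0 := h.1.ne'
    have h1 := h.2.ne'
    simp only [triRep_integrand, Pi.add_apply, ztRep_integrand, abRep, aRep_integrand, bRep_integrand]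
    field_simp
    ring, rfl⟩

/-- `(A_q + B_q) ≡ A_q + B_q` (rule (1)). [KontsevichZagier2001 §1.2 rule (1)] -/
theorem of_abRep_sub_mem_relations (q : ℚ) :
    KZ.of (abRep q) - KZ.of (aRep q) - KZ.of (bRep q) ∈ KZ.relations :=
  KZ.integrandAddRel_subset_relations ⟨2, abRep q, aRep q, bRep q, rfl, rfl, fun _ _ => rfl, rfl⟩

/-- **Part 1 assembled: `[Δ_q] − [zRep (q/2)] − [A_q] − [B_q] ∈ KZ.relations`.**
[KontsevichZagier2001 §1.2; Beukers1979 §2; this node] -/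
theorem of_triRep_sub_pieces_mem_relations (q : ℚ) :
    KZ.of (triRep q) - KZ.of (zRep (q / 2)) - KZ.of (aRep q) - KZ.of (bRep q) ∈ KZ.relations := by
  have h1 := of_triRep_sub_mem_relations q
  have h2 := of_abRep_sub_mem_relations q
  have h3 := of_zRep_sub_of_ztRep_mem_relations q
  have : KZ.of (triRep q) - KZ.of (zRep (q / 2)) - KZ.of (aRep q) - KZ.of (bRep q) =
      (KZ.of (triRep q) - KZ.of (ztRep q) - KZ.of (abRep q)) +
        (KZ.of (abRep q) - KZ.of (aRep q) - KZ.of (bRep q)) -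
          (KZ.of (zRep (q / 2)) - KZ.of (ztRep q)) := by abel
  rw [this]
  exact sub_mem (add_mem h1 h2) h3

end Summit.KontsevichZagierPeriods.RootDecompWalshStrata.Split4Pi

end
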